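import Literature.NumberTheory.Automorphic.UnitaryGroupOrbitalMeasureOfLocal
import Literature.NumberTheory.Rogawski1990.TestFunctionsPair
import Literature.Topology.RestrictedProductProdEquiv
import HarnessLib

/-!
# Adelic orbital measures of a PRODUCT `U(H₂) × U(H₁)` BUILT FROM LOCAL ONES: `dh = dh_∞ ⊗ ⊗'_v dh_v` on
# `H(𝔸) ⧸ H(𝔸)_h`, `H = U(H₂) × U(H₁)`, with the EXACT Euler product — the endoscopic side `H = U(2) × U(1)`
(Rogawski (1990) §4.3 p. 44, §5.4 p. 72; Gelbart (1975) p. 155 (10.19); Borel–Jacquet (1979) §4.1)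

Topic `NumberTheory/Automorphic`; namespace `Literature.NumberTheory.Automorphic.UnitaryGroup`. Definitions (with bodies) and
theorems; no instance, no named fact, no `sorry`. The PRODUCT-DATUM twin of ★ `UnitaryGroupOrbitalMeasureOfLocal` (one unitary datum):
the endoscopic group of `U(3)` is `H = U(2) × U(1)` [Rogawski1990, §4.9], whose adelic points in the tree are the PRODUCT
`(cmDatum L N₂ H₂).Adelic × (cmDatum L N₁ H₁).Adelic` of two unitary data (the ENGINE T1 line's `HAdelic L`; ★ `PureTensor₂`, ★
`MatchingAdeleH`, ★ `adelicStableOrbitalIntegralH`), and whose local orbital measures live on the product local groups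
`U(H₂)(L⁺_v) × U(H₁)(L⁺_v)` (the line's `HLocal L v`; they need NOT be product measures). Everything is GENERIC in
`(N₂, H₂, N₁, H₁)`.

* §0 the product models: `pairLocalPi v = U(H₂)_v × U(H₁)_v` with compact open `pairLocalInt v = U(H₂)(𝒪_v) × U(H₁)(𝒪_v)`,
  `pairLocalPiEquiv v : pairLocalPi v ≃ₜ* (cmDatum L N₂ H₂).Local v × (cmDatum L N₁ H₁).Local v`, and THE MODEL
  **`pairFinAdelicEquiv : U(H₂)(𝔸_f) × U(H₁)(𝔸_f) ≃ₜ* Πʳ_v [pairLocalPi v, pairLocalInt v]`** (★ `finAdelicEquiv` twice + ★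
  `prodContinuousMulEquiv` of `Topology/RestrictedProductProdEquiv`), `pairAdelicProdEquiv : H(𝔸) ≃ₜ* H_∞ × H(𝔸_f)`
  (★ `adelicProdEquiv` twice + ★ `ContinuousMulEquiv.prodProdProdComm'`); compatibilities `pairLocalPiEquiv_pairFinAdelicEquiv`.
* §1 **`pairFinAdelicOrbitalMeasureOfLocal L H₂ H₁ h m S₀`** — the measure on `H(𝔸_f) ⧸ C(h_f)` built from measures `m v` on
  `(U(H₂)_v × U(H₁)_v) ⧸ C(h_v)` (★ `orbitalMeasureOfLocal` at the product model); `_spec`: admissible for admissible inputs normalised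
  off `S₀` (`m v (π (U(H₂)(𝒪_v) ×ˢ U(H₁)(𝒪_v))) = 1`, the literal of ★ `UnramifiedOrbitalUnitFactorPair`), independent of `S₀`, EXACT Euler product for finite-adelic scalar pure tensors.
* §2 **`pairAdelicOrbitalMeasureOfLocal L H₂ H₁ h ma m S₀`** — the measure on `H(𝔸) ⧸ C(h)` (★ `orbitalMeasureOfProd`, `κ = 1`);
  `_spec` (admissible; `orbitalIntegral h (F₁ ⊗ F₂) = O_{h_∞}(F₁) · O_{h_f}(F₂)` EXACTLY).
* §3 pure tensors on the pair (★ `PureTensor₂`, `Rogawski1990/TestFunctionsPair`): the finite-adelic factor **`PureTensor₂.finFactor`** (`Λ_T`),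
  `eval_eq_arch_mul_finFactor` (`T.eval h = f_∞(h_∞) · Λ_T(h_f)` for unramified `T`), `finFactor_eq_prod_of_forall`, and the headline
  **`orbitalIntegral_eval_pairAdelicOrbitalMeasureOfLocal_eq_mul_prod'`**:
  `orbitalIntegral h T.eval μ = orbitalIntegral h_∞ f_∞ ma · ∏_{v∈S₂} orbitalIntegral h_v f_v (m v)` — Rogawski's `Φ(γ, f) = ∏_v Φ(γ_v, f_v)` on
  `H`, NO constant, from integrability of the adelic orbital integrand alone.
The CLASS-indexed family `OrbitalMeasureFamily.ofLocalAdelicPair` (local CLASS-indexed families `mH v`, normalisation ★ `IsNormalisedOff`-style)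
is the sequel (`UnitaryGroupPairOrbitalMeasureFamilyOfLocalAdelic`).

## References
* J. D. Rogawski, *Automorphic Representations of Unitary Groups in Three Variables* (1990), §4.3 p. 44, §4.9 p. 54, §5.4 p. 72 [Rogawski1990].
* S. Gelbart, *Automorphic forms on adele groups*, Ann. of Math. Stud. 83 (1975), p. 155 (10.19) [Gelbart1975].
* A. Borel, H. Jacquet, *Automorphic forms and automorphic representations*, PSPM 33.1 (1979), §4.1 [BorelJacquet1979].
-/

noncomputable section

open MeasureTheory Measure Set Filter Topology NumberField IsDedekindDomain
open Literature.MeasureTheory.Group Literature.MeasureTheory.RestrictedProduct Literature.Topology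
open Literature.Topology.RestrictedProduct
open scoped ENNReal NNReal RestrictedProduct

namespace Literature.NumberTheory.Automorphic

namespace UnitaryGroup

variable (L : Type) [Field L] [NumberField L] [IsCMField L] {N₂ N₁ : ℕ}
  (H₂ : Matrix (Fin N₂) (Fin N₂) L) (H₁ : Matrix (Fin N₁) (Fin N₁) L)

/-! ## §0 The product models -/

section Models

/-- `U(H₂)_v × U(H₁)_v` as a product of restricted-product factors (★ `localPi` twice). [cite: BorelJacquet1979, §4.1] -/
abbrev pairLocalPi (v : HeightOneSpectrum (𝓞 ↥(maximalRealSubfield L))) : Type :=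
  ↥(localPi L (IsCMField.complexConj L) N₂ H₂ v) × ↥(localPi L (IsCMField.complexConj L) N₁ H₁ v)

/-- `U(H₂)(𝒪_v) × U(H₁)(𝒪_v) ≤ U(H₂)_v × U(H₁)_v` — the hyperspecial `K_{H,v}` of [Rogawski1990] §4.9 (b) on the factor carriers
(★ `localInt` twice, `Subgroup.prod`). [cite: Rogawski1990, §4.9 p. 54] -/
abbrev pairLocalInt (v : HeightOneSpectrum (𝓞 ↥(maximalRealSubfield L))) : Subgroup (pairLocalPi L H₂ H₁ v) :=
  (localInt L (IsCMField.complexConj L) N₂ H₂ v).prod (localInt L (IsCMField.complexConj L) N₁ H₁ v)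

/-- `(cmDatum L N₂ H₂).Local v × (cmDatum L N₁ H₁).Local v` (the ENGINE T1 line's `HLocal L v` for `N₂ = 2`, `N₁ = 1`).
[cite: Rogawski1990, §4.9 p. 54] -/
abbrev pairLocal (v : HeightOneSpectrum (𝓞 ↥(maximalRealSubfield L))) : Type :=
  (cmDatum L N₂ H₂).Local v × (cmDatum L N₁ H₁).Local v

/-- `U(H₂)(𝔸_f) × U(H₁)(𝔸_f)` (★ `finAdelic` twice). [cite: BorelJacquet1979, §4.1] -/
abbrev pairFinAdelic : Type :=
  ↥(finAdelic (↥(maximalRealSubfield L)) L (IsCMField.complexConj L) N₂ H₂) ×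
    ↥(finAdelic (↥(maximalRealSubfield L)) L (IsCMField.complexConj L) N₁ H₁)

/-- `U(H₂)(L⁺ ⊗ ℝ) × U(H₁)(L⁺ ⊗ ℝ)` (★ `arch` twice; the line's `HInf L`). [cite: BorelJacquet1979, §4.1] -/
abbrev pairArch : Type :=
  ↥(arch (↥(maximalRealSubfield L)) L (IsCMField.complexConj L) N₂ H₂) ×
    ↥(arch (↥(maximalRealSubfield L)) L (IsCMField.complexConj L) N₁ H₁)

/-- `(cmDatum L N₂ H₂).Adelic × (cmDatum L N₁ H₁).Adelic` (the line's `HAdelic L`). [cite: BorelJacquet1979, §4.1] -/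
abbrev pairAdelic : Type := (cmDatum L N₂ H₂).Adelic × (cmDatum L N₁ H₁).Adelic

/-- The local models `pairLocalPi v ≃ₜ* pairLocal v` (★ `localPiEquiv` twice, ★ `ContinuousMulEquiv.prodCongr`). [cite: BorelJacquet1979, §4.1] -/
def pairLocalPiEquiv (v : HeightOneSpectrum (𝓞 ↥(maximalRealSubfield L))) : pairLocalPi L H₂ H₁ v ≃ₜ* pairLocal L H₂ H₁ v :=
  ContinuousMulEquiv.prodCongr (localPiEquiv L (IsCMField.complexConj L) N₂ H₂ v) (localPiEquiv L (IsCMField.complexConj L) N₁ H₁ v)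

/-- `pairLocalPiEquiv v (a, b) = (localPiEquiv v a, localPiEquiv v b)`. [cite: BorelJacquet1979, §4.1] -/
@[simp] theorem pairLocalPiEquiv_apply (v : HeightOneSpectrum (𝓞 ↥(maximalRealSubfield L))) (p : pairLocalPi L H₂ H₁ v) :
    pairLocalPiEquiv L H₂ H₁ v p =
      (localPiEquiv L (IsCMField.complexConj L) N₂ H₂ v p.1, localPiEquiv L (IsCMField.complexConj L) N₁ H₁ v p.2) := rfl

/-- `pairLocalPiEquiv v (a, b) = (localPiEquiv v a, localPiEquiv v b)` (no projections). [cite: BorelJacquet1979, §4.1] -/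
theorem pairLocalPiEquiv_apply_mk (v : HeightOneSpectrum (𝓞 ↥(maximalRealSubfield L)))
    (a : localPi L (IsCMField.complexConj L) N₂ H₂ v) (b : localPi L (IsCMField.complexConj L) N₁ H₁ v) :
    pairLocalPiEquiv L H₂ H₁ v (a, b) =
      (localPiEquiv L (IsCMField.complexConj L) N₂ H₂ v a, localPiEquiv L (IsCMField.complexConj L) N₁ H₁ v b) := rfl

/-- `U(H₂)(𝒪_v)`, `U(H₁)(𝒪_v)` are open, hence so is their product. [cite: Rogawski1990, §4.9 p. 54] -/
theorem isOpen_pairLocalInt (v : HeightOneSpectrum (𝓞 ↥(maximalRealSubfield L))) :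
    IsOpen (pairLocalInt L H₂ H₁ v : Set (pairLocalPi L H₂ H₁ v)) :=
  (isOpen_localInt L (IsCMField.complexConj L) N₂ H₂ v).prod (isOpen_localInt L (IsCMField.complexConj L) N₁ H₁ v)

/-- `Fact` form of `isOpen_pairLocalInt` (the hypothesis keying Mathlib's topological-group instance on the restricted product and
★ `orbitalMeasureOfLocal`; supplied by `haveI` where needed — no global instance). [cite: Rogawski1990, §4.9 p. 54] -/
theorem fact_isOpen_pairLocalInt :
    Fact (∀ v : HeightOneSpectrum (𝓞 ↥(maximalRealSubfield L)), IsOpen (pairLocalInt L H₂ H₁ v : Set (pairLocalPi L H₂ H₁ v))) :=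
  ⟨isOpen_pairLocalInt L H₂ H₁⟩

-- instance search for `Mul`∕`MulMemClass` on the product factor family under the binder `v` is slow (measured:
-- fails at the default 20 000, passes well below 200 000); a local synthesis budget, no global option.
set_option maxHeartbeats 400000 in
set_option synthInstance.maxHeartbeats 200000 in
/-- **THE MODEL `U(H₂)(𝔸_f) × U(H₁)(𝔸_f) ≃ₜ* Πʳ_v [U(H₂)_v × U(H₁)_v ; U(H₂)(𝒪_v) × U(H₁)(𝒪_v)]`** — the finite-adelic points of the
product as ONE restricted product: ★ `finAdelicEquiv` on each factor, then ★ `prodContinuousMulEquiv` (restricted product of products).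
[cite: BorelJacquet1979, §4.1] -/
def pairFinAdelicEquiv :
    pairFinAdelic L H₂ H₁ ≃ₜ* Πʳ v : HeightOneSpectrum (𝓞 ↥(maximalRealSubfield L)), [pairLocalPi L H₂ H₁ v, pairLocalInt L H₂ H₁ v] :=
  (ContinuousMulEquiv.prodCongr (finAdelicEquiv (↥(maximalRealSubfield L)) L (IsCMField.complexConj L) N₂ H₂)
      (finAdelicEquiv (↥(maximalRealSubfield L)) L (IsCMField.complexConj L) N₁ H₁)).trans
    (prodContinuousMulEquiv (fun v => localInt L (IsCMField.complexConj L) N₂ H₂ v)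
      (fun v => localInt L (IsCMField.complexConj L) N₁ H₁ v)
      (isOpen_localInt L (IsCMField.complexConj L) N₂ H₂) (isOpen_localInt L (IsCMField.complexConj L) N₁ H₁)).symm

/-- **Components of the model**: `(pairFinAdelicEquiv (a, b)) v = (evalPlace v a, evalPlace v b)` (★ `evalPlace` = the `v`-component
of ★ `finAdelicEquiv`). [cite: BorelJacquet1979, §4.1] -/
theorem pairFinAdelicEquiv_apply_apply (b : pairFinAdelic L H₂ H₁) (v : HeightOneSpectrum (𝓞 ↥(maximalRealSubfield L))) :
    pairFinAdelicEquiv L H₂ H₁ b v =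
      (evalPlace (↥(maximalRealSubfield L)) L (IsCMField.complexConj L) N₂ H₂ v b.1,
        evalPlace (↥(maximalRealSubfield L)) L (IsCMField.complexConj L) N₁ H₁ v b.2) := rfl

/-- The archimedean component `H(𝔸) →* H_∞`, `(h₂, h₁) ↦ (h₂,∞, h₁,∞)` (★ `archPart` twice; = ★ `PureTensor₂.archPair` as a hom).
[cite: BorelJacquet1979, §4.1] -/
abbrev pairArchPart : pairAdelic L H₂ H₁ →* pairArch L H₂ H₁ :=
  MonoidHom.prodMap (archPart (↥(maximalRealSubfield L)) L (IsCMField.complexConj L) N₂ H₂)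
    (archPart (↥(maximalRealSubfield L)) L (IsCMField.complexConj L) N₁ H₁)

/-- The finite component `H(𝔸) →* H(𝔸_f)`, `(h₂, h₁) ↦ (h₂,f, h₁,f)` (★ `finPart` twice). [cite: BorelJacquet1979, §4.1] -/
abbrev pairFinPart : pairAdelic L H₂ H₁ →* pairFinAdelic L H₂ H₁ :=
  MonoidHom.prodMap (finPart (↥(maximalRealSubfield L)) L (IsCMField.complexConj L) N₂ H₂)
    (finPart (↥(maximalRealSubfield L)) L (IsCMField.complexConj L) N₁ H₁)

/-- The local component `H(𝔸) →* H_v`, `(h₂, h₁) ↦ (h₂,v, h₁,v)` (= ★ `PureTensor₂.locPair v` as a hom). [cite: BorelJacquet1979, §4.1] -/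
abbrev pairToLocal (v : HeightOneSpectrum (𝓞 ↥(maximalRealSubfield L))) : pairAdelic L H₂ H₁ →* pairLocal L H₂ H₁ v :=
  MonoidHom.prodMap ((cmDatum L N₂ H₂).toLocal v) ((cmDatum L N₁ H₁).toLocal v)

/-- `pairArchPart (h₂, h₁) = (h₂,∞, h₁,∞)` (= ★ `PureTensor₂.archPair`, definitionally). [cite: BorelJacquet1979, §4.1] -/
@[simp] theorem pairArchPart_apply (h : pairAdelic L H₂ H₁) :
    pairArchPart L H₂ H₁ h = (archPart (↥(maximalRealSubfield L)) L (IsCMField.complexConj L) N₂ H₂ h.1,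
      archPart (↥(maximalRealSubfield L)) L (IsCMField.complexConj L) N₁ H₁ h.2) := rfl

/-- `pairFinPart (h₂, h₁) = (h₂,f, h₁,f)`. [cite: BorelJacquet1979, §4.1] -/
@[simp] theorem pairFinPart_apply (h : pairAdelic L H₂ H₁) :
    pairFinPart L H₂ H₁ h = (finPart (↥(maximalRealSubfield L)) L (IsCMField.complexConj L) N₂ H₂ h.1,
      finPart (↥(maximalRealSubfield L)) L (IsCMField.complexConj L) N₁ H₁ h.2) := rfl

/-- `pairToLocal v (h₂, h₁) = (h₂,v, h₁,v)` (= ★ `PureTensor₂.locPair v`, definitionally). [cite: BorelJacquet1979, §4.1] -/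
@[simp] theorem pairToLocal_apply (v : HeightOneSpectrum (𝓞 ↥(maximalRealSubfield L))) (h : pairAdelic L H₂ H₁) :
    pairToLocal L H₂ H₁ v h = ((cmDatum L N₂ H₂).toLocal v h.1, (cmDatum L N₁ H₁).toLocal v h.2) := rfl

/-- **`h_v` is the `v`-component of `h_f`**: `pairLocalPiEquiv v (pairFinAdelicEquiv (h_f) v) = h_v` (★ `localPiEquiv_evalPlace_finPart`
on each factor) — the compatibility `hγloc` of ★ `orbitalMeasureOfLocal`. [cite: BorelJacquet1979, §4.1] -/
theorem pairLocalPiEquiv_pairFinAdelicEquiv (v : HeightOneSpectrum (𝓞 ↥(maximalRealSubfield L))) (h : pairAdelic L H₂ H₁) :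
    pairLocalPiEquiv L H₂ H₁ v (pairFinAdelicEquiv L H₂ H₁ (pairFinPart L H₂ H₁ h) v) = pairToLocal L H₂ H₁ v h :=
  Prod.ext (localPiEquiv_evalPlace_finPart (↥(maximalRealSubfield L)) L (IsCMField.complexConj L) N₂ H₂ v h.1)
    (localPiEquiv_evalPlace_finPart (↥(maximalRealSubfield L)) L (IsCMField.complexConj L) N₁ H₁ v h.2)

/-- **`H(𝔸) ≃ₜ* H_∞ × H(𝔸_f)`**, `(h₂, h₁) ↦ ((h₂,∞, h₁,∞), (h₂,f, h₁,f))` (★ `adelicProdEquiv` on each factor, then ★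
`ContinuousMulEquiv.prodProdProdComm'`). [cite: BorelJacquet1979, §4.1] -/
def pairAdelicProdEquiv : pairAdelic L H₂ H₁ ≃ₜ* pairArch L H₂ H₁ × pairFinAdelic L H₂ H₁ :=
  (ContinuousMulEquiv.prodCongr (adelicProdEquiv (↥(maximalRealSubfield L)) L (IsCMField.complexConj L) N₂ H₂)
      (adelicProdEquiv (↥(maximalRealSubfield L)) L (IsCMField.complexConj L) N₁ H₁)).trans
    (ContinuousMulEquiv.prodProdProdComm' _ _ _ _)

/-- `pairAdelicProdEquiv h = (h_∞, h_f)`. [cite: BorelJacquet1979, §4.1] -/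
@[simp] theorem pairAdelicProdEquiv_apply (h : pairAdelic L H₂ H₁) :
    pairAdelicProdEquiv L H₂ H₁ h = (pairArchPart L H₂ H₁ h, pairFinPart L H₂ H₁ h) := rfl

/-- `(h_∞, 1)·(1, h_f) ↦ h` on both factors: the inverse of `pairAdelicProdEquiv` sends `(h_∞, h_f)` to `h`
(★ `adelicProdEquiv_symm_archPart_finPart` twice). [cite: BorelJacquet1979, §4.1] -/
theorem pairAdelicProdEquiv_symm_pairArchPart_pairFinPart (h : pairAdelic L H₂ H₁) :
    (pairAdelicProdEquiv L H₂ H₁).symm (pairArchPart L H₂ H₁ h, pairFinPart L H₂ H₁ h) = h := by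
  rw [← pairAdelicProdEquiv_apply, ContinuousMulEquiv.symm_apply_apply]

/-- `U(H₂)(𝒪_v) × U(H₁)(𝒪_v)` read on `pairLocal v` through the local model is the product of the integral levels ★ `cmLocalIntegralLevel`
(★ `localPiEquiv_symm_mem_localInt_iff` on each factor). [cite: Rogawski1990, §4.9 p. 54] -/
theorem pairLocalPiEquiv_symm_preimage_pairLocalInt (v : HeightOneSpectrum (𝓞 ↥(maximalRealSubfield L))) :
    ⇑(pairLocalPiEquiv L H₂ H₁ v).symm ⁻¹' (pairLocalInt L H₂ H₁ v : Set (pairLocalPi L H₂ H₁ v)) =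
      (cmLocalIntegralLevel L N₂ H₂ v : Set ((cmDatum L N₂ H₂).Local v)) ×ˢ
        (cmLocalIntegralLevel L N₁ H₁ v : Set ((cmDatum L N₁ H₁).Local v)) := by
  ext x
  simp only [Set.mem_preimage, SetLike.mem_coe, Subgroup.mem_prod, Set.mem_prod]
  exact Iff.and (localPiEquiv_symm_mem_localInt_iff (IsCMField.complexConj L) N₂ H₂ v x.1)
    (localPiEquiv_symm_mem_localInt_iff (IsCMField.complexConj L) N₁ H₁ v x.2)

/-- `(localPiEquiv v y₂, localPiEquiv v y₁) ∈ U(H₂)(𝒪_v) × U(H₁)(𝒪_v)` (matrix carriers) iff `y₂ ∈ U(H₂)(𝒪_v)` and `y₁ ∈ U(H₁)(𝒪_v)`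
(factor carriers; ★ `localPiEquiv_mem_localIntegralLevel_iff` on each factor). [cite: Rogawski1990, §4.9 p. 54] -/
theorem mk_localPiEquiv_mem_prod_iff (v : HeightOneSpectrum (𝓞 ↥(maximalRealSubfield L)))
    (y₂ : localPi L (IsCMField.complexConj L) N₂ H₂ v) (y₁ : localPi L (IsCMField.complexConj L) N₁ H₁ v) :
    (localPiEquiv L (IsCMField.complexConj L) N₂ H₂ v y₂, localPiEquiv L (IsCMField.complexConj L) N₁ H₁ v y₁) ∈
        (cmLocalIntegralLevel L N₂ H₂ v : Set ((cmDatum L N₂ H₂).Local v)) ×ˢ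
          (cmLocalIntegralLevel L N₁ H₁ v : Set ((cmDatum L N₁ H₁).Local v)) ↔
      y₂ ∈ localInt L (IsCMField.complexConj L) N₂ H₂ v ∧ y₁ ∈ localInt L (IsCMField.complexConj L) N₁ H₁ v :=
  Iff.and (localPiEquiv_mem_localIntegralLevel_iff (IsCMField.complexConj L) N₂ H₂ v y₂)
    (localPiEquiv_mem_localIntegralLevel_iff (IsCMField.complexConj L) N₁ H₁ v y₁)

/-- The product factors are second countable (★ `secondCountableTopology_localPi` twice). [cite: BorelJacquet1979, §4.1] -/
theorem secondCountableTopology_pairLocalPi (v : HeightOneSpectrum (𝓞 ↥(maximalRealSubfield L))) :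
    SecondCountableTopology (pairLocalPi L H₂ H₁ v) := by
  haveI := secondCountableTopology_localPi L N₂ (IsCMField.complexConj L) H₂ v
  haveI := secondCountableTopology_localPi L N₁ (IsCMField.complexConj L) H₁ v
  infer_instance

/-- The product factors are locally compact (★ `locallyCompactSpace_localPi` twice). [cite: BorelJacquet1979, §4.1] -/
theorem locallyCompactSpace_pairLocalPi (v : HeightOneSpectrum (𝓞 ↥(maximalRealSubfield L))) :
    LocallyCompactSpace (pairLocalPi L H₂ H₁ v) := by
  haveI := locallyCompactSpace_localPi L N₂ (IsCMField.complexConj L) H₂ v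
  haveI := locallyCompactSpace_localPi L N₁ (IsCMField.complexConj L) H₁ v
  infer_instance

/-- `H(𝔸_f)` is locally compact (★ `locallyCompactSpace_finAdelic` twice). [cite: BorelJacquet1979, §4.1] -/
theorem locallyCompactSpace_pairFinAdelic : LocallyCompactSpace (pairFinAdelic L H₂ H₁) := by
  haveI := locallyCompactSpace_finAdelic (↥(maximalRealSubfield L)) L (IsCMField.complexConj L) N₂ H₂
  haveI := locallyCompactSpace_finAdelic (↥(maximalRealSubfield L)) L (IsCMField.complexConj L) N₁ H₁
  infer_instance

/-- `H(𝔸_f)` is second countable. [cite: BorelJacquet1979, §4.1] -/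
theorem secondCountableTopology_pairFinAdelic : SecondCountableTopology (pairFinAdelic L H₂ H₁) := by
  haveI := secondCountableTopology_finAdelic (↥(maximalRealSubfield L)) L (IsCMField.complexConj L) N₂ H₂
  haveI := secondCountableTopology_finAdelic (↥(maximalRealSubfield L)) L (IsCMField.complexConj L) N₁ H₁
  infer_instance

/-- `H(𝔸_f)` is Hausdorff. [cite: BorelJacquet1979, §4.1] -/
theorem t2Space_pairFinAdelic : T2Space (pairFinAdelic L H₂ H₁) := by
  haveI := t2Space_finAdelic (↥(maximalRealSubfield L)) L (IsCMField.complexConj L) N₂ H₂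
  haveI := t2Space_finAdelic (↥(maximalRealSubfield L)) L (IsCMField.complexConj L) N₁ H₁
  infer_instance

end Models

/-! ## §1 The finite-adelic orbital measure of the pair from local ones -/

section Fin

variable (h : pairAdelic L H₂ H₁)
  [∀ v, MeasurableSpace (pairLocal L H₂ H₁ v ⧸ Subgroup.centralizer ({pairToLocal L H₂ H₁ v h} : Set (pairLocal L H₂ H₁ v)))]
  (m : ∀ v, Measure (pairLocal L H₂ H₁ v ⧸ Subgroup.centralizer ({pairToLocal L H₂ H₁ v h} : Set (pairLocal L H₂ H₁ v))))
  [MeasurableSpace (pairFinAdelic L H₂ H₁ ⧸ Subgroup.centralizer ({pairFinPart L H₂ H₁ h} : Set (pairFinAdelic L H₂ H₁)))]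

/-- **The orbital measure on `(U(H₂)(𝔸_f) × U(H₁)(𝔸_f)) ⧸ C(h_f)` BUILT FROM LOCAL ONES** `m v` on `(U(H₂)_v × U(H₁)_v) ⧸ C(h_v)`:
★ `orbitalMeasureOfLocal` for the model `pairFinAdelicEquiv`, local models `pairLocalPiEquiv v`, exceptional finite set `S₀` (off which
the `m v` are meant to give mass `1` to `π (U(H₂)(𝒪_v) × U(H₁)(𝒪_v))`). No rescaling. [cite: Rogawski1990, §5.4 p. 72] -/
def pairFinAdelicOrbitalMeasureOfLocal (S₀ : Finset (HeightOneSpectrum (𝓞 ↥(maximalRealSubfield L)))) :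
    Measure (pairFinAdelic L H₂ H₁ ⧸ Subgroup.centralizer ({pairFinPart L H₂ H₁ h} : Set (pairFinAdelic L H₂ H₁))) :=
  haveI := fact_isOpen_pairLocalInt L H₂ H₁
  orbitalMeasureOfLocal (fun v => pairLocalInt L H₂ H₁ v) (Lc := fun v => pairLocal L H₂ H₁ v) (fun v => pairLocalPiEquiv L H₂ H₁ v)
    (pairFinAdelicEquiv L H₂ H₁) (pairFinPart L H₂ H₁ h) (fun v => pairToLocal L H₂ H₁ v h)
    (fun v => pairLocalPiEquiv_pairFinAdelicEquiv L H₂ H₁ v h) m S₀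

variable [BorelSpace (pairFinAdelic L H₂ H₁ ⧸ Subgroup.centralizer ({pairFinPart L H₂ H₁ h} : Set (pairFinAdelic L H₂ H₁)))]
  [∀ v, BorelSpace (pairLocal L H₂ H₁ v ⧸ Subgroup.centralizer ({pairToLocal L H₂ H₁ v h} : Set (pairLocal L H₂ H₁ v)))]
  [∀ v, SMulInvariantMeasure (pairLocal L H₂ H₁ v)
    (pairLocal L H₂ H₁ v ⧸ Subgroup.centralizer ({pairToLocal L H₂ H₁ v h} : Set (pairLocal L H₂ H₁ v))) (m v)]
  [∀ v, IsFiniteMeasureOnCompacts (m v)]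

/-- **Admissibility and exact Euler products of `pairFinAdelicOrbitalMeasureOfLocal`** (★ `orbitalMeasureOfLocal_spec` dressed at the
product datum): for invariant `m v` finite on compacta with `m v (π (U(H₂)(𝒪_v) × U(H₁)(𝒪_v))) = 1` off `S₀` and `m v ≠ 0` on `S₀`,
`μ_f = pairFinAdelicOrbitalMeasureOfLocal L H₂ H₁ h m S₀` is invariant, finite on compacta, non-zero, independent of `S₀`, and for every
finite-adelic scalar pure tensor `F` (`F b = ∏_{v∈S} f_v((b₂)_v, (b₁)_v)` on the cylinders `(b₂)_v ∈ U(H₂)(𝒪_v) ∧ (b₁)_v ∈ U(H₁)(𝒪_v)`,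
`v ∉ S`, all `S ⊇ S₁ ⊇ S₀ ∪ S_{h_f}`) with `μ_f`-integrable orbital integrand:
`∏_{v∈U} orbitalIntegral h_v f_v (m v) ⟶ orbitalIntegral h_f F μ_f` and
`∀ S₂, (∀ v ∉ S₂, orbitalIntegral h_v f_v (m v) = 1) → orbitalIntegral h_f F μ_f = ∏_{v∈S₂} orbitalIntegral h_v f_v (m v)` — NO constant.
[cite: Gelbart1975, p. 155 (10.19)] [cite: Rogawski1990, §5.4 p. 72] -/
theorem pairFinAdelicOrbitalMeasureOfLocal_spec {S₀ : Finset (HeightOneSpectrum (𝓞 ↥(maximalRealSubfield L)))}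
    (hm1 : ∀ v, v ∉ S₀ → m v ((QuotientGroup.mk : pairLocal L H₂ H₁ v → _) ''
      ((cmLocalIntegralLevel L N₂ H₂ v : Set ((cmDatum L N₂ H₂).Local v)) ×ˢ
        (cmLocalIntegralLevel L N₁ H₁ v : Set ((cmDatum L N₁ H₁).Local v)))) = 1)
    (hm : ∀ v, v ∈ S₀ → m v ≠ 0) :
    SMulInvariantMeasure (pairFinAdelic L H₂ H₁) _ (pairFinAdelicOrbitalMeasureOfLocal L H₂ H₁ h m S₀) ∧
      IsFiniteMeasureOnCompacts (pairFinAdelicOrbitalMeasureOfLocal L H₂ H₁ h m S₀) ∧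
      pairFinAdelicOrbitalMeasureOfLocal L H₂ H₁ h m S₀ ≠ 0 ∧
      (∀ S₀' : Finset (HeightOneSpectrum (𝓞 ↥(maximalRealSubfield L))), S₀ ⊆ S₀' →
        pairFinAdelicOrbitalMeasureOfLocal L H₂ H₁ h m S₀' = pairFinAdelicOrbitalMeasureOfLocal L H₂ H₁ h m S₀) ∧
      ∀ (f : ∀ v, pairLocal L H₂ H₁ v → ℂ) (F : pairFinAdelic L H₂ H₁ → ℂ)
        (S₁ : Finset (HeightOneSpectrum (𝓞 ↥(maximalRealSubfield L)))),
        (∀ S : Finset (HeightOneSpectrum (𝓞 ↥(maximalRealSubfield L))), S₁ ⊆ S → ∀ b : pairFinAdelic L H₂ H₁,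
          (∀ v, v ∉ S → pairFinAdelicEquiv L H₂ H₁ b v ∈ pairLocalInt L H₂ H₁ v) →
          F b = ∏ v ∈ S, f v (pairLocalPiEquiv L H₂ H₁ v (pairFinAdelicEquiv L H₂ H₁ b v))) →
        (∀ v, v ∉ S₁ → pairFinAdelicEquiv L H₂ H₁ (pairFinPart L H₂ H₁ h) v ∈ pairLocalInt L H₂ H₁ v) →
        S₀ ⊆ S₁ →
        Integrable (descConj (pairFinPart L H₂ H₁ h) (Subgroup.centralizer ({pairFinPart L H₂ H₁ h} : Set (pairFinAdelic L H₂ H₁)))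
            (centralizer_comm _) F) (pairFinAdelicOrbitalMeasureOfLocal L H₂ H₁ h m S₀) →
          Tendsto (fun U : Finset (HeightOneSpectrum (𝓞 ↥(maximalRealSubfield L))) =>
              ∏ v ∈ U, orbitalIntegral (pairToLocal L H₂ H₁ v h) (f v) (m v)) atTop
            (𝓝 (orbitalIntegral (pairFinPart L H₂ H₁ h) F (pairFinAdelicOrbitalMeasureOfLocal L H₂ H₁ h m S₀))) ∧
          ∀ S₂ : Finset (HeightOneSpectrum (𝓞 ↥(maximalRealSubfield L))),
            (∀ v, v ∉ S₂ → orbitalIntegral (pairToLocal L H₂ H₁ v h) (f v) (m v) = 1) →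
            orbitalIntegral (pairFinPart L H₂ H₁ h) F (pairFinAdelicOrbitalMeasureOfLocal L H₂ H₁ h m S₀) =
              ∏ v ∈ S₂, orbitalIntegral (pairToLocal L H₂ H₁ v h) (f v) (m v) := by
  haveI : ∀ v, SecondCountableTopology (pairLocalPi L H₂ H₁ v) := secondCountableTopology_pairLocalPi L H₂ H₁
  haveI : ∀ v, LocallyCompactSpace (pairLocalPi L H₂ H₁ v) := locallyCompactSpace_pairLocalPi L H₂ H₁
  haveI : Countable (HeightOneSpectrum (𝓞 ↥(maximalRealSubfield L))) := countable_heightOneSpectrum ↥(maximalRealSubfield L)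
  haveI := fact_isOpen_pairLocalInt L H₂ H₁
  have hm1' : ∀ v, v ∉ S₀ → m v ((QuotientGroup.mk : pairLocal L H₂ H₁ v → _) ''
      (⇑(pairLocalPiEquiv L H₂ H₁ v).symm ⁻¹' (pairLocalInt L H₂ H₁ v : Set (pairLocalPi L H₂ H₁ v)))) = 1 := by
    intro v hv
    rw [pairLocalPiEquiv_symm_preimage_pairLocalInt]
    exact hm1 v hv
  exact orbitalMeasureOfLocal_spec (fun v => pairLocalInt L H₂ H₁ v) (Lc := fun v => pairLocal L H₂ H₁ v) (fun v => pairLocalPiEquiv L H₂ H₁ v)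
    (pairFinAdelicEquiv L H₂ H₁) (pairFinPart L H₂ H₁ h) (fun v => pairToLocal L H₂ H₁ v h)
    (fun v => pairLocalPiEquiv_pairFinAdelicEquiv L H₂ H₁ v h) m hm1' hm

end Fin

/-! ## §2 The adelic orbital measure of the pair from an archimedean and finite local ones (`κ = 1`) -/

section Adelic

variable (h : pairAdelic L H₂ H₁)
  [MeasurableSpace (pairAdelic L H₂ H₁ ⧸ Subgroup.centralizer ({h} : Set (pairAdelic L H₂ H₁)))]
  [MeasurableSpace (pairArch L H₂ H₁ ⧸ Subgroup.centralizer ({pairArchPart L H₂ H₁ h} : Set (pairArch L H₂ H₁)))]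
  [MeasurableSpace (pairFinAdelic L H₂ H₁ ⧸ Subgroup.centralizer ({pairFinPart L H₂ H₁ h} : Set (pairFinAdelic L H₂ H₁)))]
  [∀ v, MeasurableSpace (pairLocal L H₂ H₁ v ⧸ Subgroup.centralizer ({pairToLocal L H₂ H₁ v h} : Set (pairLocal L H₂ H₁ v)))]
  (ma : Measure (pairArch L H₂ H₁ ⧸ Subgroup.centralizer ({pairArchPart L H₂ H₁ h} : Set (pairArch L H₂ H₁))))
  (m : ∀ v, Measure (pairLocal L H₂ H₁ v ⧸ Subgroup.centralizer ({pairToLocal L H₂ H₁ v h} : Set (pairLocal L H₂ H₁ v))))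

/-- **The orbital measure on `H(𝔸) ⧸ C(h)` BUILT FROM LOCAL ONES**, `H = U(H₂) × U(H₁)`: `ma ⊠ (⊗'_v m v)` — ★ `orbitalMeasureOfProd` along
`pairAdelicProdEquiv⁻¹ : H_∞ × H(𝔸_f) ≃* H(𝔸)` of `ma` on `H_∞ ⧸ C(h_∞)` and `pairFinAdelicOrbitalMeasureOfLocal L H₂ H₁ h m S₀` on
`H(𝔸_f) ⧸ C(h_f)`. [cite: Rogawski1990, §5.4 p. 72] [cite: BorelJacquet1979, §4.1] -/
def pairAdelicOrbitalMeasureOfLocal (S₀ : Finset (HeightOneSpectrum (𝓞 ↥(maximalRealSubfield L)))) :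
    Measure (pairAdelic L H₂ H₁ ⧸ Subgroup.centralizer ({h} : Set (pairAdelic L H₂ H₁))) :=
  orbitalMeasureOfProd (G := pairAdelic L H₂ H₁) (pairAdelicProdEquiv L H₂ H₁).symm.toMulEquiv
    (γ₁ := pairArchPart L H₂ H₁ h) (γ₂ := pairFinPart L H₂ H₁ h)
    (pairAdelicProdEquiv_symm_pairArchPart_pairFinPart L H₂ H₁ h) ma (pairFinAdelicOrbitalMeasureOfLocal L H₂ H₁ h m S₀)

variable [BorelSpace (pairAdelic L H₂ H₁ ⧸ Subgroup.centralizer ({h} : Set (pairAdelic L H₂ H₁)))]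
  [BorelSpace (pairArch L H₂ H₁ ⧸ Subgroup.centralizer ({pairArchPart L H₂ H₁ h} : Set (pairArch L H₂ H₁)))]
  [BorelSpace (pairFinAdelic L H₂ H₁ ⧸ Subgroup.centralizer ({pairFinPart L H₂ H₁ h} : Set (pairFinAdelic L H₂ H₁)))]
  [∀ v, BorelSpace (pairLocal L H₂ H₁ v ⧸ Subgroup.centralizer ({pairToLocal L H₂ H₁ v h} : Set (pairLocal L H₂ H₁ v)))]
  [SMulInvariantMeasure (pairArch L H₂ H₁) _ ma] [IsFiniteMeasureOnCompacts ma] [SFinite ma]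
  [∀ v, SMulInvariantMeasure (pairLocal L H₂ H₁ v)
    (pairLocal L H₂ H₁ v ⧸ Subgroup.centralizer ({pairToLocal L H₂ H₁ v h} : Set (pairLocal L H₂ H₁ v))) (m v)]
  [∀ v, IsFiniteMeasureOnCompacts (m v)]

/-- **Admissibility and the EXACT `∞ × f` split for `pairAdelicOrbitalMeasureOfLocal`**: for admissible `ma ≠ 0` (s-finite) and admissible
`m v` normalised off `S₀` (`≠ 0` on `S₀`), `μ = pairAdelicOrbitalMeasureOfLocal L H₂ H₁ h ma m S₀` is invariant, finite on compacta and
non-zero, and for EVERY `F, F₁, F₂` with `F(x) = F₁(x_∞) · F₂(x_f)`: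
`orbitalIntegral h F μ = orbitalIntegral h_∞ F₁ ma · orbitalIntegral h_f F₂ μ_f` — `κ = 1`, no integrability hypothesis.
[cite: Gelbart1975, p. 155 (10.19)] [cite: Rogawski1990, §5.4 p. 72] -/
theorem pairAdelicOrbitalMeasureOfLocal_spec {S₀ : Finset (HeightOneSpectrum (𝓞 ↥(maximalRealSubfield L)))} (ha : ma ≠ 0)
    (hm1 : ∀ v, v ∉ S₀ → m v ((QuotientGroup.mk : pairLocal L H₂ H₁ v → _) ''
      ((cmLocalIntegralLevel L N₂ H₂ v : Set ((cmDatum L N₂ H₂).Local v)) ×ˢ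
        (cmLocalIntegralLevel L N₁ H₁ v : Set ((cmDatum L N₁ H₁).Local v)))) = 1)
    (hm : ∀ v, v ∈ S₀ → m v ≠ 0) :
    SMulInvariantMeasure (pairAdelic L H₂ H₁) _ (pairAdelicOrbitalMeasureOfLocal L H₂ H₁ h ma m S₀) ∧
      IsFiniteMeasureOnCompacts (pairAdelicOrbitalMeasureOfLocal L H₂ H₁ h ma m S₀) ∧
      pairAdelicOrbitalMeasureOfLocal L H₂ H₁ h ma m S₀ ≠ 0 ∧
      ∀ (F : pairAdelic L H₂ H₁ → ℂ) (F₁ : pairArch L H₂ H₁ → ℂ) (F₂ : pairFinAdelic L H₂ H₁ → ℂ),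
        (∀ x, F x = F₁ (pairArchPart L H₂ H₁ x) * F₂ (pairFinPart L H₂ H₁ x)) →
        orbitalIntegral h F (pairAdelicOrbitalMeasureOfLocal L H₂ H₁ h ma m S₀) =
          orbitalIntegral (pairArchPart L H₂ H₁ h) F₁ ma *
            orbitalIntegral (pairFinPart L H₂ H₁ h) F₂ (pairFinAdelicOrbitalMeasureOfLocal L H₂ H₁ h m S₀) := by
  haveI := locallyCompactSpace_pairFinAdelic L H₂ H₁
  haveI := secondCountableTopology_pairFinAdelic L H₂ H₁
  haveI := t2Space_pairFinAdelic L H₂ H₁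
  have hfin := pairFinAdelicOrbitalMeasureOfLocal_spec L H₂ H₁ h m hm1 hm
  haveI := hfin.1
  haveI := hfin.2.1
  haveI : SFinite (pairFinAdelicOrbitalMeasureOfLocal L H₂ H₁ h m S₀) := by
    haveI : IsLocallyFiniteMeasure (pairFinAdelicOrbitalMeasureOfLocal L H₂ H₁ h m S₀) := isLocallyFiniteMeasure_of_isFiniteMeasureOnCompacts
    haveI : SigmaFinite (pairFinAdelicOrbitalMeasureOfLocal L H₂ H₁ h m S₀) := sigmaFinite_of_locallyFinite
    infer_instance
  let E := pairAdelicProdEquiv L H₂ H₁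
  let e : pairArch L H₂ H₁ × pairFinAdelic L H₂ H₁ ≃* pairAdelic L H₂ H₁ := E.symm.toMulEquiv
  have he : Continuous e := E.symm.continuous
  have hes : Continuous e.symm := E.continuous
  have hγ : e (pairArchPart L H₂ H₁ h, pairFinPart L H₂ H₁ h) = h := pairAdelicProdEquiv_symm_pairArchPart_pairFinPart L H₂ H₁ h
  have hdef : pairAdelicOrbitalMeasureOfLocal L H₂ H₁ h ma m S₀ =
      orbitalMeasureOfProd e hγ ma (pairFinAdelicOrbitalMeasureOfLocal L H₂ H₁ h m S₀) := rfl
  refine ⟨?_, ?_, ?_, fun F F₁ F₂ hF => ?_⟩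
  · rw [hdef]; exact smulInvariantMeasure_orbitalMeasureOfProd e hγ ma _ he
  · rw [hdef]; exact isFiniteMeasureOnCompacts_orbitalMeasureOfProd e hγ ma _ he hes
  · rw [hdef]; exact orbitalMeasureOfProd_ne_zero e hγ ma _ he hes ha hfin.2.2.1
  · have hfac : ∀ a k, F (e (a, k)) = F₁ a * F₂ k := fun a k => by
      have h' := E.apply_symm_apply (a, k)
      rw [hF]
      change F₁ (E (E.symm (a, k))).1 * F₂ (E (E.symm (a, k))).2 = _
      rw [h']
    rw [orbitalIntegral_eq_integral_descConj, orbitalIntegral_eq_integral_descConj, orbitalIntegral_eq_integral_descConj, hdef]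
    exact integral_descConj_orbitalMeasureOfProd e hγ ma _ he hes F F₁ F₂ hfac

end Adelic

/-! ## §3 Pure tensors on the pair (★ `PureTensor₂`): the finite-adelic factor `Λ_T` and the EXACT Euler product
`Φ(h, f_∞ ⊗ ⊗_v f_v) = Φ_∞(h_∞, f_∞) · ∏_v Φ_v(h_v, f_v)` for `dh = dh_∞ ⊗ ⊗'_v dh_v` -/

namespace PureTensor₂

variable {L H₂ H₁}

/-- **The finite-adelic factor `Λ_T` of a pure tensor on the pair**: on `H(𝔸_f) = U(H₂)(𝔸_f) × U(H₁)(𝔸_f)`,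
`Λ_T(b) = 1_{∀ v ∉ S, b_v ∈ U(H₂)(𝒪_v) × U(H₁)(𝒪_v)} · ∏_{v∈S} f_v(b_v)`, the components `b_v = ((b₂)_v, (b₁)_v)` read as ★ `evalPlace v` through the
local models ★ `localPiEquiv v` (the twin of the inline `Λ_T` of ★ `PureTensor.eval_eq_arch_mul_finFactor`; by `pairFinAdelicEquiv_apply_apply` and
`pairLocalPiEquiv_apply` this IS `b ↦ 1_{∀ v ∉ S, (pairFinAdelicEquiv b) v ∈ pairLocalInt v} · ∏_{v∈S} f_v(pairLocalPiEquiv v ((pairFinAdelicEquiv b) v))`,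
definitionally). [cite: BorelJacquet1979, §4.1] -/
def finFactor (T : PureTensor₂ L H₂ H₁) (b : pairFinAdelic L H₂ H₁) : ℂ :=
  {b : pairFinAdelic L H₂ H₁ | ∀ v ∉ T.S,
      evalPlace (↥(maximalRealSubfield L)) L (IsCMField.complexConj L) N₂ H₂ v b.1 ∈ localInt L (IsCMField.complexConj L) N₂ H₂ v ∧
        evalPlace (↥(maximalRealSubfield L)) L (IsCMField.complexConj L) N₁ H₁ v b.2 ∈ localInt L (IsCMField.complexConj L) N₁ H₁ v}.indicator
    (fun b => ∏ v ∈ T.S, T.loc v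
      (localPiEquiv L (IsCMField.complexConj L) N₂ H₂ v (evalPlace (↥(maximalRealSubfield L)) L (IsCMField.complexConj L) N₂ H₂ v b.1),
        localPiEquiv L (IsCMField.complexConj L) N₁ H₁ v (evalPlace (↥(maximalRealSubfield L)) L (IsCMField.complexConj L) N₁ H₁ v b.2))) b

/-- The unramified set of an UNRAMIFIED tensor read on the finite parts: `h ∈ T.unramifiedSet ↔ ∀ v ∉ S, (h₂,f)_v ∈ U(H₂)(𝒪_v) ∧ (h₁,f)_v ∈ U(H₁)(𝒪_v)`
(★ `localPiEquiv_evalPlace_finPart`, ★ `localPiEquiv_mem_localIntegralLevel_iff`). [cite: BorelJacquet1979, §4.1] -/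
theorem mem_unramifiedSet_iff_finPart (T : PureTensor₂ L H₂ H₁) (hT : T.IsUnramified₂) (h : pairAdelic L H₂ H₁) :
    h ∈ T.unramifiedSet ↔ ∀ v ∉ T.S,
      evalPlace (↥(maximalRealSubfield L)) L (IsCMField.complexConj L) N₂ H₂ v
          (finPart (↥(maximalRealSubfield L)) L (IsCMField.complexConj L) N₂ H₂ h.1) ∈ localInt L (IsCMField.complexConj L) N₂ H₂ v ∧
        evalPlace (↥(maximalRealSubfield L)) L (IsCMField.complexConj L) N₁ H₁ v
          (finPart (↥(maximalRealSubfield L)) L (IsCMField.complexConj L) N₁ H₁ h.2) ∈ localInt L (IsCMField.complexConj L) N₁ H₁ v := by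
  -- the local components of `h` are those of its finite parts (★ `localPiEquiv_evalPlace_finPart`)
  have hl₂ : ∀ v, localPiEquiv L (IsCMField.complexConj L) N₂ H₂ v
      (evalPlace (↥(maximalRealSubfield L)) L (IsCMField.complexConj L) N₂ H₂ v
        (finPart (↥(maximalRealSubfield L)) L (IsCMField.complexConj L) N₂ H₂ h.1)) = (cmDatum L N₂ H₂).toLocal v h.1 :=
    fun v => localPiEquiv_evalPlace_finPart (↥(maximalRealSubfield L)) L (IsCMField.complexConj L) N₂ H₂ v h.1
  have hl₁ : ∀ v, localPiEquiv L (IsCMField.complexConj L) N₁ H₁ v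
      (evalPlace (↥(maximalRealSubfield L)) L (IsCMField.complexConj L) N₁ H₁ v
        (finPart (↥(maximalRealSubfield L)) L (IsCMField.complexConj L) N₁ H₁ h.2)) = (cmDatum L N₁ H₁).toLocal v h.2 :=
    fun v => localPiEquiv_evalPlace_finPart (↥(maximalRealSubfield L)) L (IsCMField.complexConj L) N₁ H₁ v h.2
  refine forall₂_congr fun v hv => ?_
  rw [(hT v hv).1, (hT v hv).2, ← hl₂ v, ← hl₁ v]
  exact Iff.and (localPiEquiv_mem_localIntegralLevel_iff (IsCMField.complexConj L) N₂ H₂ v _)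
    (localPiEquiv_mem_localIntegralLevel_iff (IsCMField.complexConj L) N₁ H₁ v _)

/-- On the cylinder `∀ v ∉ S, b_v ∈ U(H₂)(𝒪_v) × U(H₁)(𝒪_v)`: `Λ_T(b) = ∏_{v∈S} f_v(b_v)`. [cite: BorelJacquet1979, §4.1] -/
theorem finFactor_eq_prod_of_forall_mem (T : PureTensor₂ L H₂ H₁) (b : pairFinAdelic L H₂ H₁)
    (h : ∀ v ∉ T.S, evalPlace (↥(maximalRealSubfield L)) L (IsCMField.complexConj L) N₂ H₂ v b.1 ∈ localInt L (IsCMField.complexConj L) N₂ H₂ v ∧ evalPlace (↥(maximalRealSubfield L)) L (IsCMField.complexConj L) N₁ H₁ v b.2 ∈ localInt L (IsCMField.complexConj L) N₁ H₁ v) :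
    T.finFactor b = ∏ v ∈ T.S, T.loc v (localPiEquiv L (IsCMField.complexConj L) N₂ H₂ v (evalPlace (↥(maximalRealSubfield L)) L (IsCMField.complexConj L) N₂ H₂ v b.1), localPiEquiv L (IsCMField.complexConj L) N₁ H₁ v (evalPlace (↥(maximalRealSubfield L)) L (IsCMField.complexConj L) N₁ H₁ v b.2)) :=
  Set.indicator_of_mem (s := {b : pairFinAdelic L H₂ H₁ | ∀ v ∉ T.S, evalPlace (↥(maximalRealSubfield L)) L (IsCMField.complexConj L) N₂ H₂ v b.1 ∈ localInt L (IsCMField.complexConj L) N₂ H₂ v ∧ evalPlace (↥(maximalRealSubfield L)) L (IsCMField.complexConj L) N₁ H₁ v b.2 ∈ localInt L (IsCMField.complexConj L) N₁ H₁ v}) h _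

/-- Off that cylinder `Λ_T(b) = 0`. [cite: BorelJacquet1979, §4.1] -/
theorem finFactor_eq_zero_of_not_forall (T : PureTensor₂ L H₂ H₁) (b : pairFinAdelic L H₂ H₁)
    (h : ¬ ∀ v ∉ T.S, evalPlace (↥(maximalRealSubfield L)) L (IsCMField.complexConj L) N₂ H₂ v b.1 ∈ localInt L (IsCMField.complexConj L) N₂ H₂ v ∧ evalPlace (↥(maximalRealSubfield L)) L (IsCMField.complexConj L) N₁ H₁ v b.2 ∈ localInt L (IsCMField.complexConj L) N₁ H₁ v) :
    T.finFactor b = 0 :=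
  Set.indicator_of_notMem (s := {b : pairFinAdelic L H₂ H₁ | ∀ v ∉ T.S, evalPlace (↥(maximalRealSubfield L)) L (IsCMField.complexConj L) N₂ H₂ v b.1 ∈ localInt L (IsCMField.complexConj L) N₂ H₂ v ∧ evalPlace (↥(maximalRealSubfield L)) L (IsCMField.complexConj L) N₁ H₁ v b.2 ∈ localInt L (IsCMField.complexConj L) N₁ H₁ v}) h _

/-- **`T.eval h = f_∞(h_∞) · Λ_T(h_f)`** for an unramified pure tensor on the pair (★ `PureTensor₂.eval`, `pairArchPart`, `pairFinPart`).
[cite: BorelJacquet1979, §4.1] [cite: Rogawski1990, §4.9 p. 54] -/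
theorem eval_eq_arch_mul_finFactor (T : PureTensor₂ L H₂ H₁) (hT : T.IsUnramified₂) (h : pairAdelic L H₂ H₁) :
    T.eval h = T.arch (pairArchPart L H₂ H₁ h) * T.finFactor (pairFinPart L H₂ H₁ h) := by
  -- the local components of `h` are those of its finite parts (★ `localPiEquiv_evalPlace_finPart`)
  have hloc : ∀ v, (localPiEquiv L (IsCMField.complexConj L) N₂ H₂ v (evalPlace (↥(maximalRealSubfield L)) L (IsCMField.complexConj L) N₂ H₂ v (finPart (↥(maximalRealSubfield L)) L (IsCMField.complexConj L) N₂ H₂ h.1)),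
      localPiEquiv L (IsCMField.complexConj L) N₁ H₁ v (evalPlace (↥(maximalRealSubfield L)) L (IsCMField.complexConj L) N₁ H₁ v (finPart (↥(maximalRealSubfield L)) L (IsCMField.complexConj L) N₁ H₁ h.2))) = locPair v h :=
    fun v => Prod.ext (localPiEquiv_evalPlace_finPart (↥(maximalRealSubfield L)) L (IsCMField.complexConj L) N₂ H₂ v h.1)
      (localPiEquiv_evalPlace_finPart (↥(maximalRealSubfield L)) L (IsCMField.complexConj L) N₁ H₁ v h.2)
  obtain hm | hm := Classical.em (h ∈ T.unramifiedSet)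
  · rw [eval_eq_of_mem T hm, pairArchPart_apply, pairFinPart_apply,
      finFactor_eq_prod_of_forall_mem T (finPart (↥(maximalRealSubfield L)) L (IsCMField.complexConj L) N₂ H₂ h.1, finPart (↥(maximalRealSubfield L)) L (IsCMField.complexConj L) N₁ H₁ h.2) ((mem_unramifiedSet_iff_finPart T hT h).1 hm)]
    exact congrArg₂ (· * ·) rfl (Finset.prod_congr rfl fun v _ => congrArg (T.loc v) (hloc v).symm)
  · rw [eval_eq_zero_of_not_mem T hm, pairFinPart_apply,
      finFactor_eq_zero_of_not_forall T (finPart (↥(maximalRealSubfield L)) L (IsCMField.complexConj L) N₂ H₂ h.1, finPart (↥(maximalRealSubfield L)) L (IsCMField.complexConj L) N₁ H₁ h.2)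
        (fun hm' => hm ((mem_unramifiedSet_iff_finPart T hT h).2 hm')), mul_zero]

/-- **`Λ_T` factorises on the cylinders**: for `S ⊇ T.S` and `b` with `b_v ∈ U(H₂)(𝒪_v) × U(H₁)(𝒪_v)` for `v ∉ S`,
`Λ_T(b) = ∏_{v∈S} f_v(b_v)` — the unramified factors `f_v = 1_{U(H₂)(𝒪_v) × U(H₁)(𝒪_v)}`, `v ∈ S ∖ T.S`, reproduce the indicator
(the twin of ★ `PureTensor.finFactor_eq_prod_of_forall`). [cite: BorelJacquet1979, §4.1] [cite: Rogawski1990, §4.9 p. 54] -/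
theorem finFactor_eq_prod_of_forall (T : PureTensor₂ L H₂ H₁) (hT : T.IsUnramified₂)
    (S : Finset (HeightOneSpectrum (𝓞 ↥(maximalRealSubfield L)))) (hS : T.S ⊆ S) (b : pairFinAdelic L H₂ H₁)
    (hb : ∀ v, v ∉ S → evalPlace (↥(maximalRealSubfield L)) L (IsCMField.complexConj L) N₂ H₂ v b.1 ∈ localInt L (IsCMField.complexConj L) N₂ H₂ v ∧ evalPlace (↥(maximalRealSubfield L)) L (IsCMField.complexConj L) N₁ H₁ v b.2 ∈ localInt L (IsCMField.complexConj L) N₁ H₁ v) :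
    T.finFactor b = ∏ v ∈ S, T.loc v (localPiEquiv L (IsCMField.complexConj L) N₂ H₂ v (evalPlace (↥(maximalRealSubfield L)) L (IsCMField.complexConj L) N₂ H₂ v b.1), localPiEquiv L (IsCMField.complexConj L) N₁ H₁ v (evalPlace (↥(maximalRealSubfield L)) L (IsCMField.complexConj L) N₁ H₁ v b.2)) := by
  classical
  -- name the local factors `F v = f_v(b_v)` and the cylinder condition `P v` once
  set F : HeightOneSpectrum (𝓞 ↥(maximalRealSubfield L)) → ℂ := fun v =>
    T.loc v (localPiEquiv L (IsCMField.complexConj L) N₂ H₂ v (evalPlace (↥(maximalRealSubfield L)) L (IsCMField.complexConj L) N₂ H₂ v b.1), localPiEquiv L (IsCMField.complexConj L) N₁ H₁ v (evalPlace (↥(maximalRealSubfield L)) L (IsCMField.complexConj L) N₁ H₁ v b.2)) with hF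
  set P : HeightOneSpectrum (𝓞 ↥(maximalRealSubfield L)) → Prop := fun v =>
    evalPlace (↥(maximalRealSubfield L)) L (IsCMField.complexConj L) N₂ H₂ v b.1 ∈ localInt L (IsCMField.complexConj L) N₂ H₂ v ∧ evalPlace (↥(maximalRealSubfield L)) L (IsCMField.complexConj L) N₁ H₁ v b.2 ∈ localInt L (IsCMField.complexConj L) N₁ H₁ v with hP
  -- the unramified factors: `f_v(b_v) = 1` if `b_v ∈ U(H₂)(𝒪_v) × U(H₁)(𝒪_v)`, `= 0` if not (`v ∉ T.S`)
  have hval : ∀ v, v ∉ T.S → F v = if P v then 1 else 0 := by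
    intro v hv
    show T.loc v _ = _
    rw [T.loc_eq_indicator v hv, (hT v hv).1, (hT v hv).2, Set.indicator_apply]
    exact if_congr (mk_localPiEquiv_mem_prod_iff L H₂ H₁ v _ _) rfl rfl
  obtain hmem | hmem := Classical.em (∀ v ∉ T.S, P v)
  · have h1 : ∏ v ∈ S \ T.S, F v = 1 := Finset.prod_eq_one fun v hv => by
      rw [hval v (Finset.mem_sdiff.1 hv).2, if_pos (hmem v (Finset.mem_sdiff.1 hv).2)]
    rw [finFactor_eq_prod_of_forall_mem T b hmem]
    show ∏ v ∈ T.S, F v = ∏ v ∈ S, F v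
    rw [← Finset.prod_sdiff hS, h1, one_mul]
  · obtain ⟨v, hvT, hvK⟩ : ∃ v, v ∉ T.S ∧ ¬ P v := by
      by_contra hcon
      exact hmem fun v hv => by_contra fun hvK => hcon ⟨v, hv, hvK⟩
    have hvS : v ∈ S := by_contra fun h => hvK (hb v h)
    have h0 : ∏ v ∈ S \ T.S, F v = 0 :=
      Finset.prod_eq_zero (Finset.mem_sdiff.2 ⟨hvS, hvT⟩) (by rw [hval v hvT, if_neg hvK])
    rw [finFactor_eq_zero_of_not_forall T b hmem]
    show (0 : ℂ) = ∏ v ∈ S, F v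
    rw [← Finset.prod_sdiff hS, h0, zero_mul]

/-- `finFactor_eq_prod_of_forall` in the currency of THE MODEL (`pairFinAdelicEquiv`, `pairLocalPiEquiv`) — the factorisation hypothesis of
§1 `pairFinAdelicOrbitalMeasureOfLocal_spec`. [cite: BorelJacquet1979, §4.1] -/
theorem finFactor_eq_prod_of_forall' (T : PureTensor₂ L H₂ H₁) (hT : T.IsUnramified₂)
    (S : Finset (HeightOneSpectrum (𝓞 ↥(maximalRealSubfield L)))) (hS : T.S ⊆ S) (b : pairFinAdelic L H₂ H₁)
    (hb : ∀ v, v ∉ S → pairFinAdelicEquiv L H₂ H₁ b v ∈ pairLocalInt L H₂ H₁ v) :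
    T.finFactor b = ∏ v ∈ S, T.loc v (pairLocalPiEquiv L H₂ H₁ v (pairFinAdelicEquiv L H₂ H₁ b v)) := by
  have hb' : ∀ v, v ∉ S →
      evalPlace (↥(maximalRealSubfield L)) L (IsCMField.complexConj L) N₂ H₂ v b.1 ∈ localInt L (IsCMField.complexConj L) N₂ H₂ v ∧
        evalPlace (↥(maximalRealSubfield L)) L (IsCMField.complexConj L) N₁ H₁ v b.2 ∈ localInt L (IsCMField.complexConj L) N₁ H₁ v :=
    fun v hv => by simpa only [pairFinAdelicEquiv_apply_apply, Subgroup.mem_prod] using hb v hv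
  rw [finFactor_eq_prod_of_forall T hT S hS b hb']
  -- (`rw`'s reducible `rfl` cannot see `(cmDatum L N H).Local v = UnitaryGroup.local … v` — `cmDatum` is a `def`; `rfl` can)
  exact Finset.prod_congr rfl fun v _ => by rw [pairFinAdelicEquiv_apply_apply, pairLocalPiEquiv_apply_mk]; rfl

end PureTensor₂

section FinEuler

variable (h : pairAdelic L H₂ H₁)
  [∀ v, MeasurableSpace (pairLocal L H₂ H₁ v ⧸ Subgroup.centralizer ({pairToLocal L H₂ H₁ v h} : Set (pairLocal L H₂ H₁ v)))]
  (m : ∀ v, Measure (pairLocal L H₂ H₁ v ⧸ Subgroup.centralizer ({pairToLocal L H₂ H₁ v h} : Set (pairLocal L H₂ H₁ v))))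
  [MeasurableSpace (pairFinAdelic L H₂ H₁ ⧸ Subgroup.centralizer ({pairFinPart L H₂ H₁ h} : Set (pairFinAdelic L H₂ H₁)))]
  [BorelSpace (pairFinAdelic L H₂ H₁ ⧸ Subgroup.centralizer ({pairFinPart L H₂ H₁ h} : Set (pairFinAdelic L H₂ H₁)))]
  [∀ v, BorelSpace (pairLocal L H₂ H₁ v ⧸ Subgroup.centralizer ({pairToLocal L H₂ H₁ v h} : Set (pairLocal L H₂ H₁ v)))]
  [∀ v, SMulInvariantMeasure (pairLocal L H₂ H₁ v)
    (pairLocal L H₂ H₁ v ⧸ Subgroup.centralizer ({pairToLocal L H₂ H₁ v h} : Set (pairLocal L H₂ H₁ v))) (m v)]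
  [∀ v, IsFiniteMeasureOnCompacts (m v)]

/-- **The finite-adelic orbital integral of `Λ_T` is an EXACT finite Euler product**: for an unramified `T`, `m v (π (U(H₂)(𝒪_v) × U(H₁)(𝒪_v))) = 1`
off `S₀` (`≠ 0` on `S₀`), a `μ_f`-integrable orbital integrand of `Λ_T` at `h_f`, and local orbital integrals `Φ_v(h_v, f_v) = 1` off a finite `S₂`:
`orbitalIntegral h_f Λ_T μ_f = ∏_{v∈S₂} orbitalIntegral h_v f_v (m v)` (§1 `_spec` + `finFactor_eq_prod_of_forall`). [cite: Gelbart1975, p. 155 (10.19)]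
[cite: Rogawski1990, §5.4 p. 72] -/
theorem orbitalIntegral_pairFinPart_finFactor_ofLocal_eq_prod {S₀ : Finset (HeightOneSpectrum (𝓞 ↥(maximalRealSubfield L)))}
    (hm1 : ∀ v, v ∉ S₀ → m v ((QuotientGroup.mk : pairLocal L H₂ H₁ v → _) ''
      ((cmLocalIntegralLevel L N₂ H₂ v : Set ((cmDatum L N₂ H₂).Local v)) ×ˢ
        (cmLocalIntegralLevel L N₁ H₁ v : Set ((cmDatum L N₁ H₁).Local v)))) = 1)
    (hm : ∀ v, v ∈ S₀ → m v ≠ 0) (T : PureTensor₂ L H₂ H₁) (S₂ : Finset (HeightOneSpectrum (𝓞 ↥(maximalRealSubfield L))))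
    (hT : T.IsUnramified₂)
    (hFi : Integrable (descConj (pairFinPart L H₂ H₁ h) (Subgroup.centralizer ({pairFinPart L H₂ H₁ h} : Set (pairFinAdelic L H₂ H₁)))
      (centralizer_comm _) T.finFactor) (pairFinAdelicOrbitalMeasureOfLocal L H₂ H₁ h m S₀))
    (hf1 : ∀ v, v ∉ S₂ → orbitalIntegral (pairToLocal L H₂ H₁ v h) (T.loc v) (m v) = 1) :
    orbitalIntegral (pairFinPart L H₂ H₁ h) T.finFactor (pairFinAdelicOrbitalMeasureOfLocal L H₂ H₁ h m S₀) =
      ∏ v ∈ S₂, orbitalIntegral (pairToLocal L H₂ H₁ v h) (T.loc v) (m v) := by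
  classical
  obtain ⟨Sh, hSh⟩ := Literature.MeasureTheory.RestrictedProduct.exists_finset_forall_not_mem_apply_mem
    (fun v => pairLocalInt L H₂ H₁ v) (pairFinAdelicEquiv L H₂ H₁ (pairFinPart L H₂ H₁ h))
  exact ((pairFinAdelicOrbitalMeasureOfLocal_spec L H₂ H₁ h m hm1 hm).2.2.2.2 T.loc T.finFactor (T.S ∪ S₀ ∪ Sh)
    (fun S hS b hb => PureTensor₂.finFactor_eq_prod_of_forall' T hT S
      ((Finset.subset_union_left.trans Finset.subset_union_left).trans hS) b hb)
    (fun v hv => hSh v fun h' => hv (Finset.mem_union_right _ h'))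
    (Finset.subset_union_right.trans Finset.subset_union_left) hFi).2 S₂ hf1

end FinEuler

section AdelicEuler

variable (h : pairAdelic L H₂ H₁)
  [MeasurableSpace (pairAdelic L H₂ H₁ ⧸ Subgroup.centralizer ({h} : Set (pairAdelic L H₂ H₁)))]
  [MeasurableSpace (pairArch L H₂ H₁ ⧸ Subgroup.centralizer ({pairArchPart L H₂ H₁ h} : Set (pairArch L H₂ H₁)))]
  [MeasurableSpace (pairFinAdelic L H₂ H₁ ⧸ Subgroup.centralizer ({pairFinPart L H₂ H₁ h} : Set (pairFinAdelic L H₂ H₁)))]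
  [∀ v, MeasurableSpace (pairLocal L H₂ H₁ v ⧸ Subgroup.centralizer ({pairToLocal L H₂ H₁ v h} : Set (pairLocal L H₂ H₁ v)))]
  (ma : Measure (pairArch L H₂ H₁ ⧸ Subgroup.centralizer ({pairArchPart L H₂ H₁ h} : Set (pairArch L H₂ H₁))))
  (m : ∀ v, Measure (pairLocal L H₂ H₁ v ⧸ Subgroup.centralizer ({pairToLocal L H₂ H₁ v h} : Set (pairLocal L H₂ H₁ v))))
  [BorelSpace (pairAdelic L H₂ H₁ ⧸ Subgroup.centralizer ({h} : Set (pairAdelic L H₂ H₁)))]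
  [BorelSpace (pairArch L H₂ H₁ ⧸ Subgroup.centralizer ({pairArchPart L H₂ H₁ h} : Set (pairArch L H₂ H₁)))]
  [BorelSpace (pairFinAdelic L H₂ H₁ ⧸ Subgroup.centralizer ({pairFinPart L H₂ H₁ h} : Set (pairFinAdelic L H₂ H₁)))]
  [∀ v, BorelSpace (pairLocal L H₂ H₁ v ⧸ Subgroup.centralizer ({pairToLocal L H₂ H₁ v h} : Set (pairLocal L H₂ H₁ v)))]
  [SMulInvariantMeasure (pairArch L H₂ H₁) _ ma] [IsFiniteMeasureOnCompacts ma] [SFinite ma]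
  [∀ v, SMulInvariantMeasure (pairLocal L H₂ H₁ v)
    (pairLocal L H₂ H₁ v ⧸ Subgroup.centralizer ({pairToLocal L H₂ H₁ v h} : Set (pairLocal L H₂ H₁ v))) (m v)]
  [∀ v, IsFiniteMeasureOnCompacts (m v)]

/-- **The EXACT Euler product of the adelic orbital integral of a PURE TENSOR on the pair for `dh = dh_∞ ⊗ ⊗'_v dh_v`**: for an unramified
`T = f_∞ ⊗ ⊗_v f_v`, admissible `ma ≠ 0`, admissible `m v` normalised off `S₀`, `Λ_T` with `μ_f`-integrable orbital integrand at `h_f`, and local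
orbital integrals `Φ_v(h_v, f_v) = 1` off a finite `S₂`:
`orbitalIntegral h T.eval μ = orbitalIntegral h_∞ f_∞ ma · ∏_{v∈S₂} orbitalIntegral h_v f_v (m v)` — `Φ(γ, f) = ∏_v Φ(γ_v, f_v)` on `H`, NO constant.
[cite: Rogawski1990, §5.4 p. 72] [cite: Gelbart1975, p. 155 (10.19)] -/
theorem orbitalIntegral_eval_pairAdelicOrbitalMeasureOfLocal_eq_mul_prod {S₀ : Finset (HeightOneSpectrum (𝓞 ↥(maximalRealSubfield L)))}
    (ha : ma ≠ 0)
    (hm1 : ∀ v, v ∉ S₀ → m v ((QuotientGroup.mk : pairLocal L H₂ H₁ v → _) ''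
      ((cmLocalIntegralLevel L N₂ H₂ v : Set ((cmDatum L N₂ H₂).Local v)) ×ˢ
        (cmLocalIntegralLevel L N₁ H₁ v : Set ((cmDatum L N₁ H₁).Local v)))) = 1)
    (hm : ∀ v, v ∈ S₀ → m v ≠ 0) (T : PureTensor₂ L H₂ H₁) (S₂ : Finset (HeightOneSpectrum (𝓞 ↥(maximalRealSubfield L))))
    (hT : T.IsUnramified₂)
    (hFi : Integrable (descConj (pairFinPart L H₂ H₁ h) (Subgroup.centralizer ({pairFinPart L H₂ H₁ h} : Set (pairFinAdelic L H₂ H₁)))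
      (centralizer_comm _) T.finFactor) (pairFinAdelicOrbitalMeasureOfLocal L H₂ H₁ h m S₀))
    (hf1 : ∀ v, v ∉ S₂ → orbitalIntegral (pairToLocal L H₂ H₁ v h) (T.loc v) (m v) = 1) :
    orbitalIntegral h T.eval (pairAdelicOrbitalMeasureOfLocal L H₂ H₁ h ma m S₀) =
      orbitalIntegral (pairArchPart L H₂ H₁ h) T.arch ma * ∏ v ∈ S₂, orbitalIntegral (pairToLocal L H₂ H₁ v h) (T.loc v) (m v) := by
  rw [(pairAdelicOrbitalMeasureOfLocal_spec L H₂ H₁ h ma m ha hm1 hm).2.2.2 _ _ _ (PureTensor₂.eval_eq_arch_mul_finFactor T hT),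
    orbitalIntegral_pairFinPart_finFactor_ofLocal_eq_prod L H₂ H₁ h m hm1 hm T S₂ hT hFi hf1]

/-- **The same, from integrability at the ADELIC level** (the hypothesis consumers hold): if the orbital integrand of `T.eval` at `h` is
`μ`-integrable, then either the archimedean orbital integrand of `f_∞` vanishes `ma`-a.e. (both sides are `0`), or `Λ_T` has a `μ_f`-integrable
orbital integrand (Fubini, ★ `integrable_descConj_orbitalMeasureOfProd_iff`, `integrable_prod_iff`) and the previous theorem applies:
`orbitalIntegral h T.eval μ = orbitalIntegral h_∞ f_∞ ma · ∏_{v∈S₂} orbitalIntegral h_v f_v (m v)`. [cite: Rogawski1990, §5.4 p. 72]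
[cite: Gelbart1975, p. 155 (10.19)] -/
theorem orbitalIntegral_eval_pairAdelicOrbitalMeasureOfLocal_eq_mul_prod' {S₀ : Finset (HeightOneSpectrum (𝓞 ↥(maximalRealSubfield L)))}
    (ha : ma ≠ 0)
    (hm1 : ∀ v, v ∉ S₀ → m v ((QuotientGroup.mk : pairLocal L H₂ H₁ v → _) ''
      ((cmLocalIntegralLevel L N₂ H₂ v : Set ((cmDatum L N₂ H₂).Local v)) ×ˢ
        (cmLocalIntegralLevel L N₁ H₁ v : Set ((cmDatum L N₁ H₁).Local v)))) = 1)
    (hm : ∀ v, v ∈ S₀ → m v ≠ 0) (T : PureTensor₂ L H₂ H₁) (S₂ : Finset (HeightOneSpectrum (𝓞 ↥(maximalRealSubfield L))))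
    (hT : T.IsUnramified₂)
    (hFi : Integrable (descConj h (Subgroup.centralizer ({h} : Set (pairAdelic L H₂ H₁))) (centralizer_comm _) T.eval)
      (pairAdelicOrbitalMeasureOfLocal L H₂ H₁ h ma m S₀))
    (hf1 : ∀ v, v ∉ S₂ → orbitalIntegral (pairToLocal L H₂ H₁ v h) (T.loc v) (m v) = 1) :
    orbitalIntegral h T.eval (pairAdelicOrbitalMeasureOfLocal L H₂ H₁ h ma m S₀) =
      orbitalIntegral (pairArchPart L H₂ H₁ h) T.arch ma * ∏ v ∈ S₂, orbitalIntegral (pairToLocal L H₂ H₁ v h) (T.loc v) (m v) := by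
  classical
  haveI := locallyCompactSpace_pairFinAdelic L H₂ H₁
  haveI := secondCountableTopology_pairFinAdelic L H₂ H₁
  haveI := t2Space_pairFinAdelic L H₂ H₁
  have hfin := pairFinAdelicOrbitalMeasureOfLocal_spec L H₂ H₁ h m hm1 hm
  haveI := hfin.2.1
  haveI : SFinite (pairFinAdelicOrbitalMeasureOfLocal L H₂ H₁ h m S₀) := by
    haveI : IsLocallyFiniteMeasure (pairFinAdelicOrbitalMeasureOfLocal L H₂ H₁ h m S₀) := isLocallyFiniteMeasure_of_isFiniteMeasureOnCompacts
    haveI : SigmaFinite (pairFinAdelicOrbitalMeasureOfLocal L H₂ H₁ h m S₀) := sigmaFinite_of_locallyFinite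
    infer_instance
  -- the archimedean orbital integrand `A`
  set A := descConj (pairArchPart L H₂ H₁ h) (Subgroup.centralizer ({pairArchPart L H₂ H₁ h} : Set (pairArch L H₂ H₁)))
    (centralizer_comm _) T.arch with hA_def
  by_cases hA : A =ᵐ[ma] 0
  · have h0 : orbitalIntegral (pairArchPart L H₂ H₁ h) T.arch ma = 0 := by
      rw [orbitalIntegral_eq_integral_descConj]
      exact integral_eq_zero_of_ae hA
    rw [(pairAdelicOrbitalMeasureOfLocal_spec L H₂ H₁ h ma m ha hm1 hm).2.2.2 _ _ _ (PureTensor₂.eval_eq_arch_mul_finFactor T hT), h0,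
      zero_mul, zero_mul]
  · -- Fubini: some archimedean fibre with `A a ≠ 0` has an integrable finite-adelic factor
    let E := pairAdelicProdEquiv L H₂ H₁
    let e : pairArch L H₂ H₁ × pairFinAdelic L H₂ H₁ ≃* pairAdelic L H₂ H₁ := E.symm.toMulEquiv
    have he : Continuous e := E.symm.continuous
    have hes : Continuous e.symm := E.continuous
    have hγ : e (pairArchPart L H₂ H₁ h, pairFinPart L H₂ H₁ h) = h := pairAdelicProdEquiv_symm_pairArchPart_pairFinPart L H₂ H₁ h
    have hdef : pairAdelicOrbitalMeasureOfLocal L H₂ H₁ h ma m S₀ =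
        orbitalMeasureOfProd e hγ ma (pairFinAdelicOrbitalMeasureOfLocal L H₂ H₁ h m S₀) := rfl
    have hfac : ∀ a k, T.eval (e (a, k)) = T.arch a * T.finFactor k := fun a k => by
      have h' := E.apply_symm_apply (a, k)
      rw [PureTensor₂.eval_eq_arch_mul_finFactor T hT]
      change T.arch (E (E.symm (a, k))).1 * T.finFactor (E (E.symm (a, k))).2 = _
      rw [h']
    rw [hdef] at hFi
    have hprod := (integrable_descConj_orbitalMeasureOfProd_iff e hγ ma _ he hes _ _ _ hfac).1 hFi
    have h1 := ((integrable_prod_iff hprod.aestronglyMeasurable).1 hprod).1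
    have hex : ∃ a, A a ≠ 0 ∧ Integrable (fun k => A a *
        descConj (pairFinPart L H₂ H₁ h) _ (centralizer_comm _) T.finFactor k) (pairFinAdelicOrbitalMeasureOfLocal L H₂ H₁ h m S₀) := by
      by_contra hcon
      simp only [not_exists, not_and] at hcon
      exact hA (h1.mono fun a ha' => by_contra fun hne => hcon a hne ha')
    obtain ⟨a, hne, hint⟩ := hex
    exact orbitalIntegral_eval_pairAdelicOrbitalMeasureOfLocal_eq_mul_prod L H₂ H₁ h ma m ha hm1 hm T S₂ hT
      ((integrable_const_mul_iff (IsUnit.mk0 _ hne) _).1 hint) hf1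

end AdelicEuler

end UnitaryGroup

end Literature.NumberTheory.Automorphic
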